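import Summits.QuantumFields.BalabanUV.T4Continuum.Support.ShellMeasureLandauPrinted

/-!
# `T4Continuum.ShellMeasureLandauHolonomy` — THE HOLONOMY DICTIONARY OF SM-L1 IS A DEFINITION:
# the canonical solution of B11 Prop. 6's scheme and the canonical Landau correction of Sect. C, chosen POINTWISE by
# uniqueness; the `hhol` binder of rows S14 / S22 DISCHARGED for the holonomy they define
(cell `pub-balaban`, sub-cell `t4`, spine estimate NE7c (node U5b); NE7c formalisation swarm, crew seat
`b2b-balaban-t4-ne7c-formalise-leaf-02` gen 3 — file 7′ of the OFFERED row NE7c-S22 «S14's located residuals wired»;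
imports `ShellMeasureLandauPrinted` (S22 file 3, p210570 — hence S22 files 1–2, S14 `ShellMeasureMinimiserBonds`,
`B11Prop6Scheme`, `B13Contraction113`, `ShellMeasureLevelAssembly`) ONLY; three DATA `def`s (`solAt`, `corrAt`,
`landauExp` — configurations, not propositions; async audit D-0009), 0 `def … : Prop`, 0 sorry)

HONEST FRAMING.  Finite four-torus programme, rung (B)+1 only — NOT infinite volume, NOT a mass gap, NOT the Clay
problem, NOT summit progress; (B), `BetaPertHyp`, (B^μ) not consumed.  NE7c (`T4IndicatorShell.ShellWeightBound`) is
NOT PRINTED and NOT PROVED; «NE7c ⇐ the named binders».  Nothing printed in [Balaban1985Variational] is asserted: its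
displays (P2), (P4), (118)/(121), (44)+[4] Prop. 7, (46), (54), (75)/(103) enter as the TYPED HYPOTHESES of the files
imported, by name.

WHAT THIS FILE DOES.  Row S14 (`ShellMeasureMinimiserBonds.classifierWitness_of_prop6Scheme`, p208432) and its S22
refinements (`ShellMeasureLandauFixedPoint.classifierWitness_of_prop6Scheme_sectC` p210318,
`ShellMeasureLandauPrinted.classifierWitness_of_printed` p210570) produce END-II's (AN-bound)_j witness for a plaquette
holonomy `hol : ℝ → A` under a HOLONOMY DICTIONARY `hhol`: «for EVERY solution family `X` of the scheme (in the ball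
`‖X σ‖ ≤ ε₄`) and EVERY fixed-point family `D` of (50) (in the ball `4C₂(ε₄+a)²`), at a real `c ∈ [0,1]` the holonomy
`hol c` is the word of exponentials of the bond read-outs of the Landau exponent `Y_c − H D_c`» (the typer's diagnostic
T-NE7c-5 lives on this binder).  Both families are UNIQUE in their balls (`B11Prop6Scheme.existsUnique_solution`,
`B13Contraction113.exists_unique_fixedPoint`, consumed through S14 §1 / S22 f2 §1), so the dictionary DEFINES `hol`.
Here that definition is made and `hhol` becomes a theorem:
* §1 `solAt 𝒢 Λ W ε₄ J 𝔄` — the canonical solution of `mapT 𝒢 Λ W J 𝔄 X = X` in `‖X‖ ≤ ε₄` (`Classical.epsilon`;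
  junk if none exists); `solAt_along`: along holomorphic data `(J_σ, 𝔄_σ)` through a flat centre it IS S14 §1's
  holomorphic solution family (pointwise uniqueness), with `solAt … (J_0) (𝔄_0) = 0`.
* §2 `corrAt C ι H r Y` — the canonical Landau correction, the fixed point of (50) `C(ι Y − ι H X′) = X′` in
  `‖X′‖ ≤ r`; `corrAt_along`: along a holomorphic curve it IS S22 f2 §1's kernel family, with (55) literally;
  `landauExp C ι H r Y := Y − H (corrAt C ι H r Y)` — print's Landau exponent `A₁ + H₁B − HD(A₁ + H₁B)` ((47),
  (112), (174)) as a FUNCTION of `Y = A₁ + H₁B`.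
* §3 the composites WITHOUT `hhol`: `classifierWitness_of_prop6Scheme_canonical` (S14 §4, `Ψ = id`),
  `classifierWitness_of_prop6Scheme_sectC_canonical` (S22 f2 §4), `classifierWitness_of_printed_canonical` (S22 f3
  §2) — the SAME binder lists minus `hol`/`hhol`, plus `1 < Rad` (the complexified ray must reach `c = 1`; END-II's own
  `hR : 1 < R`), concluding END-II's `hAN` witness for the DEFINED holonomy
  `c ↦ wordExp (ℓs.map fun ℓ => ℓ (landauExp C ι H r (solAt … c + 𝔄_c)))`.
AFTER THIS FILE the SM-L1 dictionary content displayed by END-II is `hudict` ALONE: «the slot's tested variable, read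
through the chart at `x`, is `classifier hPu` of the canonical Landau holonomy at `x`» (the (R)/[dict] reading of
B14 (2.17): `u = max_p dist(U_{j,□}(V)(∂p), 1)` with `U_{j,□}` the block minimiser in the Landau gauge).  Nothing
else moves: (P2), (P4), the printed smallness, (44)/(46)/(54), the ray data (75)/(103), the read-outs stay BINDERS;
NE7c NOT PROVED; spine PROVED 0/9.  HONEST DEPENDENCY (cell): continuum YM on T⁴ ⇐ BetaPertH ∧ nine spine estimates
(0/9 proved); BetaPertH ⇐ (D1) ∧ (D4) ∧ CAP+tail; G-an2-4 gates asym, D1 and NE2/3/4.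
-/

noncomputable section

open Set Metric NormedSpace

namespace Summit.QuantumFields.BalabanUV.T4Continuum.ShellMeasureLandauHolonomy

open Literature.MathematicalPhysics.QuantumFieldTheory.Balaban1983to89
open B11Prop6Scheme (mapT Prop4Hyp norm_arg_lt)
open ShellMeasureWilsonWords (wordExp)
open ShellMeasureMinimiserBonds (solutionFamily_of_prop6Scheme classifierWitness_of_solution)
open ShellMeasureLandauExponent (rayData_of_coarseField currentData_zero)
open ShellMeasureLandauFixedPoint (landauCorrection_along landauCorrection_zero classifierWitness_landau_along)
open ShellMeasureLandauPrinted (scheme_numbers_of_printed sectC_numbers_of_printed)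

variable {𝒴 𝒴' 𝒳 𝒵 : Type*} [NormedAddCommGroup 𝒴] [NormedSpace ℂ 𝒴] [NormedAddCommGroup 𝒴'] [NormedSpace ℂ 𝒴']
  [NormedAddCommGroup 𝒳] [NormedSpace ℂ 𝒳] [NormedAddCommGroup 𝒵] [NormedSpace ℂ 𝒵]

/-! ## §1 The canonical solution of the scheme, chosen pointwise -/

/-- **THE CANONICAL SOLUTION OF THE SCHEME** at the data `(J, 𝔄)`: SOME `X` with `‖X‖ ≤ ε₄` and
`mapT 𝒢 Λ W J 𝔄 X = X` if such an `X` exists (junk otherwise).  Under the scheme's hypotheses it is THE solution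
(`solAt_eq_of_unique`, `solAt_along`): B11 Prop. 6's «exactly one solution in the space (115)» read as a definition.
A configuration, not a proposition. [folklore] -/
def solAt (𝒢 : 𝒵 →L[ℂ] 𝒴) (Λ : 𝒴 →L[ℂ] 𝒴) (W : 𝒴 → 𝒵) (ε₄ : ℝ) (J : 𝒵) (𝔄 : 𝒴) : 𝒴 :=
  Classical.epsilon fun X : 𝒴 => ‖X‖ ≤ ε₄ ∧ mapT 𝒢 Λ W J 𝔄 X = X

variable {𝒢 : 𝒵 →L[ℂ] 𝒴} {Λ : 𝒴 →L[ℂ] 𝒴} {W : 𝒴 → 𝒵} {B₀ θ C₄ a₃ : ℝ}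

/-- if a solution exists in the ball, `solAt` is one. [folklore] -/
theorem solAt_spec {ε₄ : ℝ} {J : 𝒵} {𝔄 : 𝒴} (h : ∃ X : 𝒴, ‖X‖ ≤ ε₄ ∧ mapT 𝒢 Λ W J 𝔄 X = X) :
    ‖solAt 𝒢 Λ W ε₄ J 𝔄‖ ≤ ε₄ ∧ mapT 𝒢 Λ W J 𝔄 (solAt 𝒢 Λ W ε₄ J 𝔄) = solAt 𝒢 Λ W ε₄ J 𝔄 :=
  Classical.epsilon_spec h

/-- uniqueness in the ball identifies `solAt` with any given solution. [folklore] -/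
theorem solAt_eq_of_unique {ε₄ : ℝ} {J : 𝒵} {𝔄 X : 𝒴} (hX : ‖X‖ ≤ ε₄) (hfix : mapT 𝒢 Λ W J 𝔄 X = X)
    (huniq : ∀ X' : 𝒴, ‖X'‖ ≤ ε₄ → mapT 𝒢 Λ W J 𝔄 X' = X' → X' = X) :
    solAt 𝒢 Λ W ε₄ J 𝔄 = X :=
  have h := solAt_spec (𝒢 := 𝒢) (Λ := Λ) (W := W) ⟨X, hX, hfix⟩
  huniq _ h.1 h.2

/-- **`solAt` ALONG THE SCHEME IS S14's HOLOMORPHIC SOLUTION FAMILY.**  Under the hypotheses of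
`ShellMeasureMinimiserBonds.solutionFamily_of_prop6Scheme` ((P2) `h𝒢`, `hΛ`; (P4) `hW`; the numbers (118)/(121);
holomorphic data `J_σ`, `𝔄_σ` on the disc `‖σ‖ < Rad` with `‖J_σ‖ ≤ j`, `‖𝔄_σ‖ < a` and a flat centre): the
pointwise canonical solution `σ ↦ solAt 𝒢 Λ W ε₄ (J_σ) (𝔄_σ)` is holomorphic on the disc, lies in the ball
`‖·‖ ≤ ε₄`, solves the scheme, is the UNIQUE solution in that ball, and vanishes at the centre. [folklore] -/
theorem solAt_along [CompleteSpace 𝒴] (h𝒢 : ∀ f, ‖𝒢 f‖ ≤ B₀ * ‖f‖) (hΛ : ∀ Y, ‖Λ Y‖ ≤ θ * ‖Y‖)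
    (hW : Prop4Hyp W C₄ a₃) (hB₀ : 0 ≤ B₀) (hC₄ : 0 ≤ C₄) (hθ : 0 ≤ θ) {j a ε₄ : ℝ} (hε₄ : 0 ≤ ε₄)
    (hdom : 2 * (ε₄ + a) ≤ a₃) (hself : B₀ * j + θ * (ε₄ + a) + B₀ * C₄ * (ε₄ + a) ^ 2 ≤ ε₄)
    (hcontr : θ + 4 * B₀ * C₄ * (ε₄ + a) < 1) {Rad : ℝ} (hRad : 0 < Rad) {Jf : ℂ → 𝒵} {𝔄f : ℂ → 𝒴}
    (hJd : DifferentiableOn ℂ Jf (ball 0 Rad)) (h𝔄d : DifferentiableOn ℂ 𝔄f (ball 0 Rad))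
    (hJ : ∀ σ ∈ ball (0 : ℂ) Rad, ‖Jf σ‖ ≤ j) (h𝔄 : ∀ σ ∈ ball (0 : ℂ) Rad, ‖𝔄f σ‖ < a)
    (hJ0 : Jf 0 = 0) (h𝔄0 : 𝔄f 0 = 0) :
    DifferentiableOn ℂ (fun σ => solAt 𝒢 Λ W ε₄ (Jf σ) (𝔄f σ)) (ball 0 Rad) ∧
      (∀ σ ∈ ball (0 : ℂ) Rad, ‖solAt 𝒢 Λ W ε₄ (Jf σ) (𝔄f σ)‖ ≤ ε₄ ∧
        mapT 𝒢 Λ W (Jf σ) (𝔄f σ) (solAt 𝒢 Λ W ε₄ (Jf σ) (𝔄f σ)) = solAt 𝒢 Λ W ε₄ (Jf σ) (𝔄f σ) ∧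
        ∀ X' : 𝒴, ‖X'‖ ≤ ε₄ → mapT 𝒢 Λ W (Jf σ) (𝔄f σ) X' = X' → X' = solAt 𝒢 Λ W ε₄ (Jf σ) (𝔄f σ)) ∧
      solAt 𝒢 Λ W ε₄ (Jf 0) (𝔄f 0) = 0 := by
  obtain ⟨X, hXd, hX, hX0⟩ := solutionFamily_of_prop6Scheme h𝒢 hΛ hW hB₀ hC₄ hθ hε₄ hdom hself hcontr hRad hJd
    h𝔄d hJ h𝔄 hJ0 h𝔄0
  have heq : ∀ σ ∈ ball (0 : ℂ) Rad, solAt 𝒢 Λ W ε₄ (Jf σ) (𝔄f σ) = X σ := fun σ hσ =>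
    solAt_eq_of_unique (hX σ hσ).1 (hX σ hσ).2.1 (hX σ hσ).2.2
  refine ⟨hXd.congr heq, fun σ hσ => ?_, ?_⟩
  · rw [heq σ hσ]; exact hX σ hσ
  · rw [heq 0 (mem_ball_self hRad)]; exact hX0

/-! ## §2 The canonical Landau correction and the Landau exponent -/

/-- **THE CANONICAL LANDAU CORRECTION** `D(Y)`: SOME fixed point of (50) `C(ι Y − ι H X′) = X′` in the closed ball
`‖X′‖ ≤ r` if one exists (junk otherwise).  Under Sect. C's hypotheses it is THE fixed point (`corrAt_eq_of_unique`,
`corrAt_along`): [Balaban1985Variational] p. 286 «there exists exactly one fixed point» read as a definition.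
A configuration, not a proposition. [folklore] -/
def corrAt (C : 𝒴' → 𝒳) (ι : 𝒴 →L[ℂ] 𝒴') (H : 𝒳 →L[ℂ] 𝒴) (r : ℝ) (Y : 𝒴) : 𝒳 :=
  Classical.epsilon fun X' : 𝒳 => X' ∈ closedBall (0 : 𝒳) r ∧ C (ι Y - ι (H X')) = X'

/-- **THE CANONICAL LANDAU EXPONENT** `Ψ̂(Y) = Y − H D(Y)` — print's `A₁ + H₁B − HD(A₁ + H₁B)` ((47), (112), (174))
as a function of `Y = A₁ + H₁B`, with `D` the canonical correction `corrAt`. A configuration. [folklore] -/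
def landauExp (C : 𝒴' → 𝒳) (ι : 𝒴 →L[ℂ] 𝒴') (H : 𝒳 →L[ℂ] 𝒴) (r : ℝ) (Y : 𝒴) : 𝒴 :=
  Y - H (corrAt C ι H r Y)

section Corr

variable {C : 𝒴' → 𝒳} {ι : 𝒴 →L[ℂ] 𝒴'} {H : 𝒳 →L[ℂ] 𝒴} {r : ℝ} {Y : 𝒴}

/-- if a fixed point exists in the ball, `corrAt` is one. [folklore] -/
theorem corrAt_spec (h : ∃ X' : 𝒳, X' ∈ closedBall (0 : 𝒳) r ∧ C (ι Y - ι (H X')) = X') :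
    corrAt C ι H r Y ∈ closedBall (0 : 𝒳) r ∧ C (ι Y - ι (H (corrAt C ι H r Y))) = corrAt C ι H r Y :=
  Classical.epsilon_spec h

/-- uniqueness in the ball identifies `corrAt` with any given fixed point. [folklore] -/
theorem corrAt_eq_of_unique {X' : 𝒳} (hX' : X' ∈ closedBall (0 : 𝒳) r) (hfix : C (ι Y - ι (H X')) = X')
    (huniq : ∀ X'' ∈ closedBall (0 : 𝒳) r, C (ι Y - ι (H X'')) = X'' → X'' = X') : corrAt C ι H r Y = X' :=
  have h := corrAt_spec (C := C) (ι := ι) (H := H) ⟨X', hX', hfix⟩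
  huniq _ h.1 h.2

/-- the Landau exponent unfolded. [folklore] -/
theorem landauExp_apply (C : 𝒴' → 𝒳) (ι : 𝒴 →L[ℂ] 𝒴') (H : 𝒳 →L[ℂ] 𝒴) (r : ℝ) (Y : 𝒴) :
    landauExp C ι H r Y = Y - H (corrAt C ι H r Y) := rfl

end Corr

/-- **`corrAt` ALONG A HOLOMORPHIC CURVE IS S22 f2's KERNEL LANDAU CORRECTION.**  Under the hypotheses of
`ShellMeasureLandauFixedPoint.landauCorrection_along` ((44)+[4] Prop. 7 `hCq`/`hCd` on `ball 0 R`; the scaling `hι`;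
(46) `hH`; the (54)-smallness `9C₂B₀ε < 1`, `3ε ≤ R`; a holomorphic curve `Y` on the disc with `‖Y σ‖ < ε`): the
pointwise canonical correction `σ ↦ corrAt C ι H (4C₂ε²) (Y σ)` is holomorphic on the disc, lies in the closed ball
`4C₂ε²`, solves (50), is the UNIQUE solution there, and obeys (55) `‖D_σ‖ ≤ 4C₂‖ι Y_σ‖²` literally. [folklore] -/
theorem corrAt_along [CompleteSpace 𝒳] {C : 𝒴' → 𝒳} {C₂ R : ℝ} (hC₂ : 0 ≤ C₂)
    (hCq : ∀ Z : 𝒴', ‖Z‖ < R → ‖C Z‖ ≤ C₂ * ‖Z‖ ^ 2) (hCd : DifferentiableOn ℂ C (ball 0 R))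
    (ι : 𝒴 →L[ℂ] 𝒴') (hι : ∀ Y, ‖ι Y‖ ≤ ‖Y‖) (H : 𝒳 →L[ℂ] 𝒴) {B₀ : ℝ} (hB₀ : 0 ≤ B₀)
    (hH : ∀ X, ‖H X‖ ≤ B₀ * ‖X‖) {ε Rad : ℝ} (hq : 9 * C₂ * B₀ * ε < 1) (hRC : 3 * ε ≤ R)
    {Y : ℂ → 𝒴} (hYd : DifferentiableOn ℂ Y (ball 0 Rad)) (hY : ∀ σ ∈ ball (0 : ℂ) Rad, ‖Y σ‖ < ε) :
    DifferentiableOn ℂ (fun σ => corrAt C ι H (4 * C₂ * ε ^ 2) (Y σ)) (ball 0 Rad) ∧ ∀ σ ∈ ball (0 : ℂ) Rad,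
      corrAt C ι H (4 * C₂ * ε ^ 2) (Y σ) ∈ closedBall (0 : 𝒳) (4 * C₂ * ε ^ 2) ∧
      C (ι (Y σ) - ι (H (corrAt C ι H (4 * C₂ * ε ^ 2) (Y σ)))) = corrAt C ι H (4 * C₂ * ε ^ 2) (Y σ) ∧
      (∀ X' ∈ closedBall (0 : 𝒳) (4 * C₂ * ε ^ 2), C (ι (Y σ) - ι (H X')) = X' →
        X' = corrAt C ι H (4 * C₂ * ε ^ 2) (Y σ)) ∧
      ‖corrAt C ι H (4 * C₂ * ε ^ 2) (Y σ)‖ ≤ 4 * C₂ * ‖ι (Y σ)‖ ^ 2 := by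
  obtain ⟨Dc, hDd, hD⟩ := landauCorrection_along hC₂ hCq hCd ι hι H hB₀ hH hq hRC hYd hY
  have heq : ∀ σ ∈ ball (0 : ℂ) Rad, corrAt C ι H (4 * C₂ * ε ^ 2) (Y σ) = Dc σ := fun σ hσ =>
    corrAt_eq_of_unique (hD σ hσ).1 (hD σ hσ).2.1 (hD σ hσ).2.2.1
  refine ⟨hDd.congr heq, fun σ hσ => ?_⟩
  rw [heq σ hσ]
  exact hD σ hσ

/-- a real parameter `c ∈ [0,1]` lies on the disc `‖σ‖ < Rad` as soon as `1 < Rad`. [folklore] -/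
theorem ofReal_mem_ball {c Rad : ℝ} (hc0 : 0 ≤ c) (hc1 : c ≤ 1) (hRad1 : 1 < Rad) :
    (c : ℂ) ∈ ball (0 : ℂ) Rad := by
  rw [mem_ball_zero_iff, Complex.norm_real, Real.norm_of_nonneg hc0]
  linarith

/-! ## §3 The (AN-bound) witnesses for the CANONICAL holonomies — `hhol` discharged -/

section Composite

variable {A : Type*} [NormedRing A] [NormedAlgebra ℂ A] [CompleteSpace A] [CompleteSpace 𝒴] [CompleteSpace 𝒳]

omit [NormedAddCommGroup 𝒴'] [NormedSpace ℂ 𝒴'] [NormedAddCommGroup 𝒳] [NormedSpace ℂ 𝒳] [CompleteSpace 𝒳] in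
/-- **S14 §4 WITHOUT `hhol` (the case `Ψ = id`).**  `ShellMeasureMinimiserBonds.classifierWitness_of_prop6Scheme` with
its binder list VERBATIM except: `hol`/`hhol` REMOVED, `1 < Rad` ADDED; conclusion: END-II's `hAN` witness for the
DEFINED holonomy `c ↦ wordExp (ℓs.map fun ℓ => ℓ (solAt 𝒢 Λ W ε₄ (J_c) (𝔄_c) + 𝔄_c))` (read-outs of THE solution),
`H_AN = e^{m·κ(ε₄+a)} − 1`. [folklore] -/
theorem classifierWitness_of_prop6Scheme_canonical (h𝒢 : ∀ f, ‖𝒢 f‖ ≤ B₀ * ‖f‖) (hΛ : ∀ Y, ‖Λ Y‖ ≤ θ * ‖Y‖)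
    (hW : Prop4Hyp W C₄ a₃) (hB₀ : 0 ≤ B₀) (hC₄ : 0 ≤ C₄) (hθ : 0 ≤ θ) {j a ε₄ : ℝ} (hε₄ : 0 ≤ ε₄)
    (hdom : 2 * (ε₄ + a) ≤ a₃) (hself : B₀ * j + θ * (ε₄ + a) + B₀ * C₄ * (ε₄ + a) ^ 2 ≤ ε₄)
    (hcontr : θ + 4 * B₀ * C₄ * (ε₄ + a) < 1) {Rad : ℝ} (hRad1 : 1 < Rad) {Jf : ℂ → 𝒵} {𝔄f : ℂ → 𝒴}
    (hJd : DifferentiableOn ℂ Jf (ball 0 Rad)) (h𝔄d : DifferentiableOn ℂ 𝔄f (ball 0 Rad))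
    (hJ : ∀ σ ∈ ball (0 : ℂ) Rad, ‖Jf σ‖ ≤ j) (h𝔄 : ∀ σ ∈ ball (0 : ℂ) Rad, ‖𝔄f σ‖ < a)
    (hJ0 : Jf 0 = 0) (h𝔄0 : 𝔄f 0 = 0)
    (ℓs : List (𝒴 →L[ℂ] A)) {κ : ℝ} (hκ : 0 ≤ κ) (hℓ : ∀ ℓ ∈ ℓs, ∀ Y, ‖ℓ Y‖ ≤ κ * ‖Y‖) :
    ∃ f : ℂ → A, DifferentiableOn ℂ f (ball 0 Rad) ∧
      (∀ w ∈ ball (0 : ℂ) Rad, ‖f w‖ ≤ Real.exp (ℓs.length * (κ * (ε₄ + a))) - 1) ∧ f 0 = 0 ∧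
      ∀ c : ℝ, 0 ≤ c → c ≤ 1 → f (c : ℂ) =
        wordExp (ℓs.map fun ℓ => ℓ (solAt 𝒢 Λ W ε₄ (Jf c) (𝔄f c) + 𝔄f c)) - 1 := by
  have hRad : 0 < Rad := by linarith
  obtain ⟨hXd, hX, hX0⟩ := solAt_along h𝒢 hΛ hW hB₀ hC₄ hθ hε₄ hdom hself hcontr hRad hJd h𝔄d hJ h𝔄 hJ0 h𝔄0
  exact classifierWitness_of_solution hXd h𝔄d (fun σ hσ => (hX σ hσ).1) h𝔄 hX0 h𝔄0 ℓs hκ hℓ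
    (hol := fun c => wordExp (ℓs.map fun ℓ => ℓ (solAt 𝒢 Λ W ε₄ (Jf c) (𝔄f c) + 𝔄f c))) (fun _ _ _ => rfl)

/-- **S22 f2 §4 WITHOUT `hhol`.**  `ShellMeasureLandauFixedPoint.classifierWitness_of_prop6Scheme_sectC` with its binder
list VERBATIM ((P2) `h𝒢`/`hΛ`; (P4) `hW`; (118)/(121); holomorphic ray data `Jf`, `𝔄f` with a flat centre; (44)+[4]
Prop. 7 `hCq`/`hCd`; the scaling `hι`; (46) `hH`; the (54)-smallness at `ε₄ + a`; the read-outs `ℓs`) except: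
`hol`/`hhol` REMOVED, `1 < Rad` ADDED (`0 < Rad` dropped as implied).  CONCLUSION: END-II's `hAN` witness for the
DEFINED Landau holonomy `c ↦ wordExp (ℓs.map fun ℓ => ℓ (landauExp C ι H (4C₂(ε₄+a)²) (solAt 𝒢 Λ W ε₄ (J_c) (𝔄_c)
+ 𝔄_c)))`, `H_AN = e^{m·κ·((ε₄+a) + 4C₂B₀(ε₄+a)²)} − 1`.  Proof: §1/§2 identify the canonical objects with the kernel
families of S14 §1 / S22 f2 §1 on the disc, which contains `[0,1]`. [folklore] -/
theorem classifierWitness_of_prop6Scheme_sectC_canonical (h𝒢 : ∀ f, ‖𝒢 f‖ ≤ B₀ * ‖f‖)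
    (hΛ : ∀ Y, ‖Λ Y‖ ≤ θ * ‖Y‖) (hW : Prop4Hyp W C₄ a₃) (hB₀ : 0 ≤ B₀) (hC₄ : 0 ≤ C₄) (hθ : 0 ≤ θ)
    {j a ε₄ : ℝ} (hε₄ : 0 ≤ ε₄) (hdom : 2 * (ε₄ + a) ≤ a₃)
    (hself : B₀ * j + θ * (ε₄ + a) + B₀ * C₄ * (ε₄ + a) ^ 2 ≤ ε₄) (hcontr : θ + 4 * B₀ * C₄ * (ε₄ + a) < 1)
    {Rad : ℝ} (hRad1 : 1 < Rad) {Jf : ℂ → 𝒵} {𝔄f : ℂ → 𝒴} (hJd : DifferentiableOn ℂ Jf (ball 0 Rad))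
    (h𝔄d : DifferentiableOn ℂ 𝔄f (ball 0 Rad)) (hJ : ∀ σ ∈ ball (0 : ℂ) Rad, ‖Jf σ‖ ≤ j)
    (h𝔄 : ∀ σ ∈ ball (0 : ℂ) Rad, ‖𝔄f σ‖ < a) (hJ0 : Jf 0 = 0) (h𝔄0 : 𝔄f 0 = 0)
    {C : 𝒴' → 𝒳} {C₂ R : ℝ} (hC₂ : 0 ≤ C₂) (hCq : ∀ Z : 𝒴', ‖Z‖ < R → ‖C Z‖ ≤ C₂ * ‖Z‖ ^ 2)
    (hCd : DifferentiableOn ℂ C (ball 0 R)) (ι : 𝒴 →L[ℂ] 𝒴') (hι : ∀ Y, ‖ι Y‖ ≤ ‖Y‖) (H : 𝒳 →L[ℂ] 𝒴)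
    (hH : ∀ X, ‖H X‖ ≤ B₀ * ‖X‖) (hq : 9 * C₂ * B₀ * (ε₄ + a) < 1) (hRC : 3 * (ε₄ + a) ≤ R)
    (ℓs : List (𝒴 →L[ℂ] A)) {κ : ℝ} (hκ : 0 ≤ κ) (hℓ : ∀ ℓ ∈ ℓs, ∀ Y, ‖ℓ Y‖ ≤ κ * ‖Y‖) :
    ∃ f : ℂ → A, DifferentiableOn ℂ f (ball 0 Rad) ∧
      (∀ w ∈ ball (0 : ℂ) Rad, ‖f w‖ ≤
        Real.exp (ℓs.length * (κ * ((ε₄ + a) + B₀ * (4 * C₂ * (ε₄ + a) ^ 2)))) - 1) ∧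
      f 0 = 0 ∧ ∀ c : ℝ, 0 ≤ c → c ≤ 1 → f (c : ℂ) =
        wordExp (ℓs.map fun ℓ => ℓ (landauExp C ι H (4 * C₂ * (ε₄ + a) ^ 2)
          (solAt 𝒢 Λ W ε₄ (Jf c) (𝔄f c) + 𝔄f c))) - 1 := by
  have hRad : 0 < Rad := by linarith
  obtain ⟨hXd, hX, hX0⟩ := solAt_along h𝒢 hΛ hW hB₀ hC₄ hθ hε₄ hdom hself hcontr hRad hJd h𝔄d hJ h𝔄 hJ0 h𝔄0
  -- the curve `Y_σ = X_σ + 𝔄_σ` of THE solution and its canonical correction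
  have hYd : DifferentiableOn ℂ (fun σ => solAt 𝒢 Λ W ε₄ (Jf σ) (𝔄f σ) + 𝔄f σ) (ball 0 Rad) := hXd.add h𝔄d
  have hY : ∀ σ ∈ ball (0 : ℂ) Rad, ‖solAt 𝒢 Λ W ε₄ (Jf σ) (𝔄f σ) + 𝔄f σ‖ < ε₄ + a := fun σ hσ =>
    norm_arg_lt (h𝔄 σ hσ) (hX σ hσ).1
  have hY0 : (fun σ => solAt 𝒢 Λ W ε₄ (Jf σ) (𝔄f σ) + 𝔄f σ) 0 = 0 := by
    show solAt 𝒢 Λ W ε₄ (Jf 0) (𝔄f 0) + 𝔄f 0 = 0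
    rw [hX0, h𝔄0, add_zero]
  obtain ⟨hDd, hD⟩ := corrAt_along hC₂ hCq hCd ι hι H hB₀ hH hq hRC hYd hY
  have hDb : ∀ σ ∈ ball (0 : ℂ) Rad,
      ‖corrAt C ι H (4 * C₂ * (ε₄ + a) ^ 2) (solAt 𝒢 Λ W ε₄ (Jf σ) (𝔄f σ) + 𝔄f σ)‖ ≤
        4 * C₂ * (ε₄ + a) ^ 2 := fun σ hσ => mem_closedBall_zero_iff.1 (hD σ hσ).1
  have hD0 : corrAt C ι H (4 * C₂ * (ε₄ + a) ^ 2) (solAt 𝒢 Λ W ε₄ (Jf 0) (𝔄f 0) + 𝔄f 0) = 0 :=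
    landauCorrection_zero hRad (Z := fun σ => ι (solAt 𝒢 Λ W ε₄ (Jf σ) (𝔄f σ) + 𝔄f σ))
      (Dc := fun σ => corrAt C ι H (4 * C₂ * (ε₄ + a) ^ 2) (solAt 𝒢 Λ W ε₄ (Jf σ) (𝔄f σ) + 𝔄f σ))
      (by show ι (solAt 𝒢 Λ W ε₄ (Jf 0) (𝔄f 0) + 𝔄f 0) = 0
          rw [hX0, h𝔄0, add_zero, map_zero]) fun σ hσ => (hD σ hσ).2.2.2
  exact classifierWitness_landau_along H hB₀ hH hYd hY hY0 hDd hDb hD0 ℓs hκ hℓ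
    (hol := fun c => wordExp (ℓs.map fun ℓ => ℓ (landauExp C ι H (4 * C₂ * (ε₄ + a) ^ 2)
      (solAt 𝒢 Λ W ε₄ (Jf c) (𝔄f c) + 𝔄f c)))) (fun _ _ _ => rfl)

omit [CompleteSpace A] in
/-- **THE DISCHARGED DICTIONARY, STATED.**  Under the same hypotheses the `hhol` binder of
`ShellMeasureLandauFixedPoint.classifierWitness_of_prop6Scheme_sectC` HOLDS for the canonical Landau holonomy: for EVERY
solution family `X` of the scheme in the ball `‖X σ‖ ≤ ε₄` and EVERY fixed-point family `D` of (50) in the ball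
`4C₂(ε₄+a)²` along `Y = X + 𝔄`, at every `c ∈ [0,1]` the word of read-outs of `Y_c − H D_c` IS the canonical one —
uniqueness in the two balls (`solAt_along`, `corrAt_along`).  The typer's T-NE7c-5 locus is thereby a theorem about a
definition, not a hypothesis. [folklore] -/
theorem hhol_canonical (h𝒢 : ∀ f, ‖𝒢 f‖ ≤ B₀ * ‖f‖)
    (hΛ : ∀ Y, ‖Λ Y‖ ≤ θ * ‖Y‖) (hW : Prop4Hyp W C₄ a₃) (hB₀ : 0 ≤ B₀) (hC₄ : 0 ≤ C₄) (hθ : 0 ≤ θ)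
    {j a ε₄ : ℝ} (hε₄ : 0 ≤ ε₄) (hdom : 2 * (ε₄ + a) ≤ a₃)
    (hself : B₀ * j + θ * (ε₄ + a) + B₀ * C₄ * (ε₄ + a) ^ 2 ≤ ε₄) (hcontr : θ + 4 * B₀ * C₄ * (ε₄ + a) < 1)
    {Rad : ℝ} (hRad1 : 1 < Rad) {Jf : ℂ → 𝒵} {𝔄f : ℂ → 𝒴} (hJd : DifferentiableOn ℂ Jf (ball 0 Rad))
    (h𝔄d : DifferentiableOn ℂ 𝔄f (ball 0 Rad)) (hJ : ∀ σ ∈ ball (0 : ℂ) Rad, ‖Jf σ‖ ≤ j)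
    (h𝔄 : ∀ σ ∈ ball (0 : ℂ) Rad, ‖𝔄f σ‖ < a) (hJ0 : Jf 0 = 0) (h𝔄0 : 𝔄f 0 = 0)
    {C : 𝒴' → 𝒳} {C₂ R : ℝ} (hC₂ : 0 ≤ C₂) (hCq : ∀ Z : 𝒴', ‖Z‖ < R → ‖C Z‖ ≤ C₂ * ‖Z‖ ^ 2)
    (hCd : DifferentiableOn ℂ C (ball 0 R)) (ι : 𝒴 →L[ℂ] 𝒴') (hι : ∀ Y, ‖ι Y‖ ≤ ‖Y‖) (H : 𝒳 →L[ℂ] 𝒴)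
    (hH : ∀ X, ‖H X‖ ≤ B₀ * ‖X‖) (hq : 9 * C₂ * B₀ * (ε₄ + a) < 1) (hRC : 3 * (ε₄ + a) ≤ R)
    (ℓs : List (𝒴 →L[ℂ] A)) :
    ∀ X : ℂ → 𝒴, (∀ σ ∈ ball (0 : ℂ) Rad, ‖X σ‖ ≤ ε₄ ∧ mapT 𝒢 Λ W (Jf σ) (𝔄f σ) (X σ) = X σ) →
      ∀ D : ℂ → 𝒳, (∀ σ ∈ ball (0 : ℂ) Rad, D σ ∈ closedBall (0 : 𝒳) (4 * C₂ * (ε₄ + a) ^ 2) ∧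
        C (ι (X σ + 𝔄f σ) - ι (H (D σ))) = D σ) →
      ∀ c : ℝ, 0 ≤ c → c ≤ 1 →
        wordExp (ℓs.map fun ℓ => ℓ (landauExp C ι H (4 * C₂ * (ε₄ + a) ^ 2)
          (solAt 𝒢 Λ W ε₄ (Jf c) (𝔄f c) + 𝔄f c))) =
        wordExp (ℓs.map fun ℓ => ℓ ((X (c : ℂ) + 𝔄f (c : ℂ)) - H (D (c : ℂ)))) := by
  have hRad : 0 < Rad := by linarith
  obtain ⟨hXd, hX, hX0⟩ := solAt_along h𝒢 hΛ hW hB₀ hC₄ hθ hε₄ hdom hself hcontr hRad hJd h𝔄d hJ h𝔄 hJ0 h𝔄0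
  have hYd : DifferentiableOn ℂ (fun σ => solAt 𝒢 Λ W ε₄ (Jf σ) (𝔄f σ) + 𝔄f σ) (ball 0 Rad) := hXd.add h𝔄d
  have hY : ∀ σ ∈ ball (0 : ℂ) Rad, ‖solAt 𝒢 Λ W ε₄ (Jf σ) (𝔄f σ) + 𝔄f σ‖ < ε₄ + a := fun σ hσ =>
    norm_arg_lt (h𝔄 σ hσ) (hX σ hσ).1
  obtain ⟨-, hD⟩ := corrAt_along hC₂ hCq hCd ι hι H hB₀ hH hq hRC hYd hY
  intro X hX' D hD' c hc0 hc1
  have hc : (c : ℂ) ∈ ball (0 : ℂ) Rad := ofReal_mem_ball hc0 hc1 hRad1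
  have hXc : X c = solAt 𝒢 Λ W ε₄ (Jf c) (𝔄f c) := (hX c hc).2.2 (X c) (hX' c hc).1 (hX' c hc).2
  have hDc : D c = corrAt C ι H (4 * C₂ * (ε₄ + a) ^ 2) (solAt 𝒢 Λ W ε₄ (Jf c) (𝔄f c) + 𝔄f c) :=
    (hD c hc).2.2.1 (D c) (hD' c hc).1 (by rw [← hXc]; exact (hD' c hc).2)
  rw [hXc, hDc]
  rfl

end Composite

/-! ## §4 S22 f3's printed composite WITHOUT `hhol` -/

section Printed

variable {ℬ A : Type*} [NormedAddCommGroup ℬ] [NormedSpace ℂ ℬ] [NormedRing A] [NormedAlgebra ℂ A]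
  [CompleteSpace A] [CompleteSpace 𝒴] [CompleteSpace 𝒳]

/-- **SM-L1 ALONG THE CONTRACTION RAY FROM THE PRINTED CONDITIONS, FOR THE CANONICAL LANDAU HOLONOMY — NO DICTIONARY
BINDER.**  `ShellMeasureLandauPrinted.classifierWitness_of_printed` with its binder list VERBATIM ((P2) `h𝒢`; (P4)
`hW`; Prop. 6's printed smallness `h1`/`h2`/`h3` with `dL ≤ B₃`; the coarse-field family `B_σ` ((75) TYPE) and (103)
`hH₁`; (44)+[4] Prop. 7 `hCq`/`hCd`; the scaling `hι`; (46) `hH`; Prop. 3's printed smallness `18C₂B₀ε₃ ≤ 1` with the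
located coupling and `3ε₃ ≤ R`; the read-outs) except: `hol`/`hhol` REMOVED, `1 < Rad` in place of `0 < Rad`.
CONCLUSION: END-II's `hAN` witness on `ball 0 Rad` for the holonomy DEFINED from the data —
`c ↦ wordExp (ℓs.map fun ℓ => ℓ (landauExp C ι H (4C₂(ε₄ + 2dLB₀C₁ε₁)²) (solAt 𝒢 0 W ε₄ 0 (H₁ B_c) + H₁ B_c)))`,
i.e. the word of read-outs of `Ψ̂(Y_c)`, `Y_c = 𝒜₁(c) + H₁B_c` with `𝒜₁(c)` THE solution of (111) at `H₁B_c` — with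
`H_AN = e^{m·κ·((ε₄ + 2dLB₀C₁ε₁) + 4C₂B₀(ε₄ + 2dLB₀C₁ε₁)²)} − 1`.  Honest reading after this theorem: SM-L1 ⇐ the
listed DISPLAYED-TYPE binders; the holonomy dictionary is a definition; END-II's `hudict` carries the identification
with the slot's tested variable.  NOT an instance; NE7c NOT PROVED. [folklore] -/
theorem classifierWitness_of_printed_canonical {𝒢 : 𝒵 →L[ℂ] 𝒴} {W : 𝒴 → 𝒵} {B₀ C₄ a₃ : ℝ}
    (h𝒢 : ∀ f, ‖𝒢 f‖ ≤ B₀ * ‖f‖) (hW : Prop4Hyp W C₄ a₃) (hB₀ : 0 < B₀)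
    (hC₄ : 0 ≤ C₄) {dL C₁ B₃ ε₁ ε₄ : ℝ} (hdL : 0 ≤ dL) (hC₁ : 0 ≤ C₁) (hε₁ : 0 ≤ ε₁) (hε₄ : 0 ≤ ε₄)
    (hB₃ : dL ≤ B₃) (h1 : 2 * B₀ * C₁ * B₃ * ε₁ ≤ ε₄) (h2 : 4 * ε₄ ≤ a₃) (h3 : 16 * B₀ * C₄ * ε₄ ≤ 1)
    (H₁ : ℬ →L[ℂ] 𝒴) (hH₁ : ∀ B, ‖H₁ B‖ ≤ B₀ * ‖B‖) {Rad : ℝ} (hRad1 : 1 < Rad) {Bf : ℂ → ℬ}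
    (hBd : DifferentiableOn ℂ Bf (ball 0 Rad)) (hB : ∀ σ ∈ ball (0 : ℂ) Rad, ‖Bf σ‖ < 2 * dL * C₁ * ε₁)
    (hB0 : Bf 0 = 0)
    {C : 𝒴' → 𝒳} {C₂ R ε₃ : ℝ} (hC₂ : 0 ≤ C₂) (hCq : ∀ Z : 𝒴', ‖Z‖ < R → ‖C Z‖ ≤ C₂ * ‖Z‖ ^ 2)
    (hCd : DifferentiableOn ℂ C (ball 0 R)) (ι : 𝒴 →L[ℂ] 𝒴') (hι : ∀ Y, ‖ι Y‖ ≤ ‖Y‖) (H : 𝒳 →L[ℂ] 𝒴)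
    (hH : ∀ X, ‖H X‖ ≤ B₀ * ‖X‖) (h18 : 18 * C₂ * B₀ * ε₃ ≤ 1)
    (hcoup : ε₄ + B₀ * (2 * dL * C₁ * ε₁) ≤ ε₃) (h3R : 3 * ε₃ ≤ R)
    (ℓs : List (𝒴 →L[ℂ] A)) {κ : ℝ} (hκ : 0 ≤ κ) (hℓ : ∀ ℓ ∈ ℓs, ∀ Y, ‖ℓ Y‖ ≤ κ * ‖Y‖) :
    ∃ f : ℂ → A, DifferentiableOn ℂ f (ball 0 Rad) ∧
      (∀ w ∈ ball (0 : ℂ) Rad, ‖f w‖ ≤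
        Real.exp (ℓs.length * (κ * ((ε₄ + B₀ * (2 * dL * C₁ * ε₁)) +
          B₀ * (4 * C₂ * (ε₄ + B₀ * (2 * dL * C₁ * ε₁)) ^ 2)))) - 1) ∧
      f 0 = 0 ∧ ∀ c : ℝ, 0 ≤ c → c ≤ 1 → f (c : ℂ) =
        wordExp (ℓs.map fun ℓ => ℓ (landauExp C ι H (4 * C₂ * (ε₄ + B₀ * (2 * dL * C₁ * ε₁)) ^ 2)
          (solAt 𝒢 0 W ε₄ (0 : 𝒵) (H₁ (Bf c)) + H₁ (Bf c)))) - 1 := by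
  obtain ⟨hdom, hself, hcontr, -⟩ := scheme_numbers_of_printed hdL hB₀.le hC₁ hC₄ hε₁ hε₄ hB₃ h1 h2 h3
  obtain ⟨hq, hRC⟩ := sectC_numbers_of_printed hC₂ hB₀.le h18 hcoup h3R
  obtain ⟨h𝔄d, h𝔄0, h𝔄⟩ := rayData_of_coarseField H₁ hH₁ hB₀ hBd hB hB0
  obtain ⟨hJd, hJ, hJ0⟩ := currentData_zero (𝒵 := 𝒵) Rad
  have hΛ : ∀ Y : 𝒴, ‖(0 : 𝒴 →L[ℂ] 𝒴) Y‖ ≤ 0 * ‖Y‖ := fun Y => by simp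
  exact classifierWitness_of_prop6Scheme_sectC_canonical h𝒢 hΛ hW hB₀.le hC₄ le_rfl hε₄ hdom hself hcontr hRad1
    hJd h𝔄d hJ h𝔄 hJ0 h𝔄0 hC₂ hCq hCd ι hι H hH hq hRC ℓs hκ hℓ

end Printed

end Summit.QuantumFields.BalabanUV.T4Continuum.ShellMeasureLandauHolonomy
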